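import Mathlib.NumberTheory.NumberField.Units.DirichletTheorem
import Mathlib.RingTheory.DedekindDomain.SelmerGroup
import Mathlib.RingTheory.ClassGroup.Basic
import Mathlib.Data.ZMod.QuotientGroup
import Literature.NumberTheory.QuadraticForms.SUnitSquareClasses
import HarnessLib

/-!
# O'Meara 65:6 proved: `(𝔲 : 𝔲²) = 2^s` for the `S`-units of a number field

Sibling proof file of `Literature.NumberTheory.QuadraticForms.SUnitSquareClasses` (namespace
`Literature.OMeara65`), all declarations fully proved. It discharges the named fact
`sUnits_sq_relIndex_eq K` (O'Meara, *Introduction to quadratic forms*, Prop. 65:6: for the group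
`𝔲` of `S`-units of a global field, `(𝔲 : 𝔲²) = 2^s`, `s = |Ω - S|`) for number fields:
`sUnits_sq_relIndex K T : (𝔲 : 𝔲²) = 2 ^ (|T| + #InfinitePlace K)` for **every** finite set `T` of
finite places (`𝔲 = (↑T).unit K`, Mathlib's `T`-units), and `sUnits_sq_relIndex_eq_holds`.

O'Meara deduces 65:6 from the `S`-unit theorem (`𝔲 ≅ μ × ℤ^{s-1}`, his 33:10 — in the tree as
`Literature/NumberTheory/DiophantineGeometry/SUnitTheorem.lean`, `Literature.NumberTheory.DiophantineGeometry.NumberField.finrank_sUnit`,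
`sUnit_exist_unique_eq_mul_prod`) and 65:5. Mathlib (pin) itself has no `S`-unit theorem; the
proof below is independent of it and uses only Dirichlet's unit theorem for `𝓞_Kˣ`
(`NumberField.Units.exist_unique_eq_mul_prod`: `𝓞_Kˣ = μ · ∏ fundSystem^ℤ` uniquely) and the
finiteness of the class group, through the following index computation.

* `index_range_powMonoidHom_eq` : for `φ : G →* M` with `M` without `2`-torsion,
  `(G : G²) = (φ(G) : φ(G)²) · (ker φ : (ker φ)²)` (both factors as relative indices).
* `relIndex_sq_of_index_ne_zero` : a subgroup `Λ` of finite index in `ℤ^ι` has `(Λ : Λ²) = 2^|ι|`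
  (`x ↦ x²` is injective, so `(ℤ^ι : Λ²) = (ℤ^ι : Λ)(Λ : Λ²) = (ℤ^ι : (ℤ^ι)²)(ℤ^ι : Λ)`).
* `index_range_powMonoidHom_units` : `(𝓞_Kˣ : 𝓞_Kˣ²) = 2 ^ #InfinitePlace K` — apply the first
  lemma to the exponent map `𝓞_Kˣ → ℤ^{rank K}` of Dirichlet's theorem (kernel `μ = torsion K`,
  onto), with `(μ : μ²) = 2` (`relIndex_torsion_sq`: the kernel of squaring on the finite group
  `μ` is `{±1}`) and `rank K + 1 = #InfinitePlace K`; this is 65:5/65:6 for `S` = all finite places.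
* `sUnits_sq_relIndex` : apply the first lemma to the valuation vector `𝔲 → ℤ^T`; its kernel is
  `𝓞_Kˣ` (an element of `K` that is a unit at every finite place is a global unit,
  `mem_range_unitsMap_of_valuation_eq_one`), and its image has finite index in `ℤ^T` because for
  each `v ∈ T` a generator of the principal ideal `v^h` (`h` the class number) is a `T`-unit
  supported at `v` alone (`exists_valuation_ne_one_and_eq_one`).

## References

* O. T. O'Meara, *Introduction to quadratic forms*, Grundlehren 117, Springer (1963), §65B,
  Prop. 65:5 and Prop. 65:6; §33F (`S`-units).
-/

noncomputable section

namespace Literature.NumberTheory.QuadraticForms.OMeara65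

open Subgroup

/-! Generic index lemmas for squares -/

section Generic

variable {G M : Type*} [CommGroup G] [CommGroup M]

/-- Squares in a subgroup: `(u.map (x ↦ x²)).relIndex u` equals the index of the squares of the
group `↥u`. [folklore] -/
theorem relIndex_map_powMonoidHom_eq (u : Subgroup G) :
    (u.map (powMonoidHom 2)).relIndex u = ((powMonoidHom 2 : u →* u).range).index := by
  rw [Subgroup.relIndex]
  congr 1
  ext x
  simp only [mem_subgroupOf, mem_map, MonoidHom.mem_range, powMonoidHom_apply]
  constructor
  · rintro ⟨y, hy, hyx⟩
    exact ⟨⟨y, hy⟩, Subtype.ext (by simpa using hyx)⟩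
  · rintro ⟨y, rfl⟩
    exact ⟨y, y.2, by simp⟩

/-- **Index of squares via a homomorphism to a group without `2`-torsion**: for `φ : G →* M` with
`x² = 1 → x = 1` in `M`, `(G : G²) = (φ(G) : φ(G)²) · (ker φ : (ker φ)²)`. [folklore] -/
theorem index_range_powMonoidHom_eq (φ : G →* M) (hM : ∀ x : M, x ^ 2 = 1 → x = 1) :
    ((powMonoidHom 2 : G →* G).range).index =
      ((φ.range).map (powMonoidHom 2)).relIndex φ.range *
        ((φ.ker).map (powMonoidHom 2)).relIndex φ.ker := by
  set H : Subgroup G := (powMonoidHom 2 : G →* G).range with hH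
  set N : Subgroup G := φ.ker with hN
  have h1 : H.index = H.relIndex (H ⊔ N) * (H ⊔ N).index :=
    (relIndex_mul_index (le_sup_left : H ≤ H ⊔ N)).symm
  -- the image part
  have h2 : (H ⊔ N).index = ((φ.range).map (powMonoidHom 2)).relIndex φ.range := by
    have h := relIndex_map_map φ H ⊤
    rw [top_sup_eq, relIndex_top_right] at h
    rw [← h, ← MonoidHom.range_eq_map]
    congr 1
    rw [hH, MonoidHom.map_range, MonoidHom.map_range]
    congr 1
    ext x
    simp [map_pow]
  -- the kernel part
  have h3 : H.relIndex (H ⊔ N) = ((φ.ker).map (powMonoidHom 2)).relIndex φ.ker := by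
    rw [relIndex_sup_left, ← inf_relIndex_right]
    congr 1
    ext x
    simp only [mem_inf, hH, hN, MonoidHom.mem_range, powMonoidHom_apply, mem_map,
      MonoidHom.mem_ker]
    constructor
    · rintro ⟨⟨y, rfl⟩, hx⟩
      refine ⟨y, hM _ ?_, rfl⟩
      rw [← map_pow, hx]
    · rintro ⟨y, hy, rfl⟩
      exact ⟨⟨y, rfl⟩, by rw [map_pow, hy, one_pow]⟩
  rw [h1, h2, h3, mul_comm]

/-- Transport: for an injective `ι : G →* M`, `(ι(G) : ι(G)²)`-index equals `(G : G²)`. [folklore] -/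
theorem relIndex_map_powMonoidHom_range (ι : G →* M) (hι : Function.Injective ι) :
    ((ι.range).map (powMonoidHom 2)).relIndex ι.range =
      ((powMonoidHom 2 : G →* G).range).index := by
  have h := relIndex_map_map_of_injective ((⊤ : Subgroup G).map (powMonoidHom 2)) ⊤ hι
  rw [relIndex_top_right, ← MonoidHom.range_eq_map] at h
  have hc : (powMonoidHom 2 : M →* M).comp ι = ι.comp (powMonoidHom 2) := by
    ext x; simp [map_pow]
  rw [← h, MonoidHom.range_eq_map ι, MonoidHom.range_eq_map (powMonoidHom 2 : G →* G),
    Subgroup.map_map, Subgroup.map_map, hc]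

end Generic

/-! Squares in `ℤ^ι` -/

section FreePart

/-- The squares of `Multiplicative ℤ` have index `2`. [folklore] -/
theorem index_range_powMonoidHom_multiplicative_int :
    ((powMonoidHom 2 : Multiplicative ℤ →* Multiplicative ℤ).range).index = 2 := by
  have h : (powMonoidHom 2 : Multiplicative ℤ →* Multiplicative ℤ).range =
      AddSubgroup.toSubgroup (AddSubgroup.zmultiples (2 : ℤ)) := by
    ext x
    simp only [MonoidHom.mem_range, powMonoidHom_apply, Multiplicative.mem_toSubgroup,
      AddSubgroup.mem_zmultiples_iff]
    constructor
    · rintro ⟨y, rfl⟩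
      exact ⟨Multiplicative.toAdd y, by rw [toAdd_pow, smul_eq_mul, nsmul_eq_mul, mul_comm]; rfl⟩
    · rintro ⟨k, hk⟩
      refine ⟨Multiplicative.ofAdd k, ?_⟩
      apply Multiplicative.toAdd.injective
      rw [toAdd_pow, toAdd_ofAdd, ← hk, smul_eq_mul, nsmul_eq_mul, mul_comm]
      rfl
  rw [h, AddSubgroup.index_toSubgroup, Int.index_zmultiples]
  rfl

/-- For a subgroup `Λ` of finite index in `ℤ^ι` (written multiplicatively), `(Λ : Λ²) = 2^|ι|`. [folklore] -/
theorem relIndex_sq_of_index_ne_zero {ι : Type*} [Fintype ι]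
    (Λ : Subgroup (ι → Multiplicative ℤ)) (hΛ : Λ.index ≠ 0) :
    (Λ.map (powMonoidHom 2)).relIndex Λ = 2 ^ Fintype.card ι := by
  set P : (ι → Multiplicative ℤ) →* (ι → Multiplicative ℤ) := powMonoidHom 2 with hP
  have hPinj : Function.Injective P := by
    intro x y hxy
    have : (x / y) ^ 2 = 1 := by rw [div_pow]; exact div_eq_one.2 hxy
    exact div_eq_one.1 (sq_eq_one.mp this)
  have hker : P.ker = ⊥ := (MonoidHom.ker_eq_bot_iff P).2 hPinj
  have h1 : (Λ.map P).index = Λ.index * P.range.index := by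
    rw [index_map, hker, sup_bot_eq]
  have hle : Λ.map P ≤ Λ := by
    rintro _ ⟨x, hx, rfl⟩
    rw [hP, powMonoidHom_apply]
    exact Λ.pow_mem hx 2
  have h2 : (Λ.map P).relIndex Λ * Λ.index = (Λ.map P).index := relIndex_mul_index hle
  have hrange : P.range.index = 2 ^ Fintype.card ι := by
    have : P.range = Subgroup.pi Set.univ
        (fun _ : ι ↦ (powMonoidHom 2 : Multiplicative ℤ →* Multiplicative ℤ).range) := by
      ext f
      simp only [MonoidHom.mem_range, Subgroup.mem_pi, Set.mem_univ, forall_const,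
        powMonoidHom_apply, hP]
      constructor
      · rintro ⟨g, rfl⟩ i
        exact ⟨g i, rfl⟩
      · intro h
        choose g hg using h
        exact ⟨g, funext fun i ↦ by simp [hg i]⟩
    rw [this, index_pi, Finset.prod_const, index_range_powMonoidHom_multiplicative_int,
      Finset.card_univ]
  have h3 : (Λ.map P).relIndex Λ * Λ.index = 2 ^ Fintype.card ι * Λ.index := by
    rw [h2, h1, hrange, mul_comm]
  exact Nat.eq_of_mul_eq_mul_right (Nat.pos_of_ne_zero hΛ) h3

end FreePart

/-! Units of `𝓞 K` modulo squares: `[𝓞ˣ : 𝓞ˣ²] = 2 ^ #InfinitePlace` -/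

section UnitsNF

open _root_.NumberField NumberField.Units

variable (K : Type*) [Field K] [NumberField K]

omit [NumberField K] in
/-- The torsion-free quotient `(𝓞 K)ˣ ⧸ torsion` has no `2`-torsion. [folklore] -/
theorem unitsModTorsion_eq_one_of_sq (x : (𝓞 K)ˣ ⧸ torsion K) (hx : x ^ 2 = 1) : x = 1 := by
  induction x using QuotientGroup.induction_on with
  | H y =>
    rw [← QuotientGroup.mk_pow, QuotientGroup.eq_one_iff] at hx
    rw [QuotientGroup.eq_one_iff]
    rw [torsion, CommGroup.mem_torsion] at hx ⊢
    exact IsOfFinOrder.of_pow hx two_ne_zero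

omit [NumberField K] in
/-- The elements of square `1` in `(𝓞 K)ˣ` are `±1`. [folklore] -/
theorem sq_eq_one_iff_units (x : (𝓞 K)ˣ) : x ^ 2 = 1 ↔ x = 1 ∨ x = -1 := by
  constructor
  · intro h
    have h' : ((x : 𝓞 K) : K) ^ 2 = 1 := by
      have := congrArg (fun u : (𝓞 K)ˣ ↦ ((u : 𝓞 K) : K)) h
      simpa using this
    rw [sq] at h'
    rcases mul_self_eq_one_iff.1 h' with h1 | h1
    · left
      apply NumberField.Units.coe_injective
      simpa using h1
    · right
      apply NumberField.Units.coe_injective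
      simpa using h1
  · rintro (rfl | rfl) <;> simp

/-- `(μ : μ²) = 2` for the torsion `μ` of `(𝓞 K)ˣ` (a finite cyclic group of even order,
containing `-1`). [folklore] -/
theorem relIndex_torsion_sq :
    ((torsion K).map (powMonoidHom 2)).relIndex (torsion K) = 2 := by
  rw [relIndex_map_powMonoidHom_eq]
  set P : torsion K →* torsion K := powMonoidHom 2 with hP
  haveI : Finite (torsion K) := inferInstance
  -- `|ker P| = 2`
  have hker : Nat.card P.ker = 2 := by
    rw [Nat.card_eq_two_iff]
    have h1mem : (-1 : (𝓞 K)ˣ) ∈ torsion K := by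
      rw [torsion, CommGroup.mem_torsion, isOfFinOrder_iff_pow_eq_one]
      exact ⟨2, two_pos, by simp⟩
    refine ⟨⟨1, one_mem _⟩, ⟨⟨-1, h1mem⟩, ?_⟩, ?_, ?_⟩
    · rw [MonoidHom.mem_ker, hP, powMonoidHom_apply]
      exact Subtype.ext (by simp)
    · intro h
      have := congrArg (fun z : P.ker ↦ ((z : torsion K) : (𝓞 K)ˣ)) h
      exact neg_units_ne_self (1 : (𝓞 K)ˣ) this.symm
    · rw [Set.eq_univ_iff_forall]
      rintro ⟨⟨x, hxμ⟩, hx⟩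
      rw [MonoidHom.mem_ker, hP, powMonoidHom_apply] at hx
      have hx' : x ^ 2 = 1 := by
        have := congrArg (fun z : torsion K ↦ (z : (𝓞 K)ˣ)) hx
        simpa using this
      rcases (sq_eq_one_iff_units K x).1 hx' with rfl | rfl
      · exact Or.inl rfl
      · exact Or.inr rfl
  -- counting
  have h1 : Nat.card P.ker * P.ker.index = Nat.card (torsion K) := card_mul_index P.ker
  have h2 : P.ker.index = Nat.card P.range := index_ker P
  have h3 : Nat.card P.range * P.range.index = Nat.card (torsion K) := card_mul_index P.range
  have hne : Nat.card P.range ≠ 0 := Nat.card_pos.ne'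
  rw [hker, h2] at h1
  have : Nat.card P.range * P.range.index = Nat.card P.range * 2 := by rw [h3, ← h1, mul_comm]
  exact Nat.eq_of_mul_eq_mul_left (Nat.pos_of_ne_zero hne) this

/-- **`[(𝓞 K)ˣ : ((𝓞 K)ˣ)²] = 2 ^ #InfinitePlace K`** (Dirichlet: `(𝓞 K)ˣ ≅ μ × ℤ^{r₁+r₂-1}` with
`μ` finite cyclic of even order; O'Meara 65:5/65:6 with `S` = all finite places, `s = r₁ + r₂`).
[cite: Omeara1963, §65B Prop. 65:5 and Prop. 65:6] -/
theorem index_range_powMonoidHom_units :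
    ((powMonoidHom 2 : (𝓞 K)ˣ →* (𝓞 K)ˣ).range).index = 2 ^ Fintype.card (InfinitePlace K) := by
  classical
  -- the exponent map `φ : (𝓞 K)ˣ →* ℤ^{rank K}` of Dirichlet's theorem
  have hex := fun x : (𝓞 K)ˣ ↦ exist_unique_eq_mul_prod (K := K) x
  let g : (𝓞 K)ˣ → torsion K × (Fin (rank K) → ℤ) := fun x ↦ (hex x).exists.choose
  have hg : ∀ x, x = (g x).1 * ∏ i, fundSystem K i ^ ((g x).2 i) := fun x ↦
    (hex x).exists.choose_spec
  have hgu : ∀ x (y : torsion K × (Fin (rank K) → ℤ)),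
      x = y.1 * ∏ i, fundSystem K i ^ (y.2 i) → y = g x := fun x y hy ↦
    (hex x).unique hy (hg x)
  have hgmul : ∀ x y, g (x * y) = ((g x).1 * (g y).1, (g x).2 + (g y).2) := by
    intro x y
    refine (hgu (x * y) _ ?_).symm
    conv_lhs => rw [hg x, hg y]
    simp only [Pi.add_apply, zpow_add, Finset.prod_mul_distrib, Subgroup.coe_mul]
    exact mul_mul_mul_comm _ _ _ _
  have hgone : g 1 = (1, 0) := (hgu 1 (1, 0) (by simp)).symm
  let φ : (𝓞 K)ˣ →* (Fin (rank K) → Multiplicative ℤ) :=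
    { toFun := fun x i ↦ Multiplicative.ofAdd ((g x).2 i)
      map_one' := by
        funext i
        simp [hgone]
      map_mul' := by
        intro x y
        funext i
        simp [hgmul] }
  have hφ : ∀ x i, φ x i = Multiplicative.ofAdd ((g x).2 i) := fun _ _ ↦ rfl
  -- kernel `= torsion`, image `= ⊤`
  have hker : φ.ker = torsion K := by
    ext x
    rw [MonoidHom.mem_ker]
    constructor
    · intro h
      have h2 : (g x).2 = 0 := by
        funext i
        have := congrFun h i
        rw [hφ] at this
        simpa using this
      rw [hg x, h2]
      simp only [Pi.zero_apply, zpow_zero, Finset.prod_const_one, mul_one]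
      exact (g x).1.2
    · intro hx
      have h := hgu x (⟨x, hx⟩, 0) (by simp)
      funext i
      rw [hφ, ← h]
      simp
  have hrange : φ.range = ⊤ := by
    rw [eq_top_iff]
    intro e _
    let x : (𝓞 K)ˣ := ∏ i, fundSystem K i ^ (Multiplicative.toAdd (e i))
    have h := hgu x (1, fun i ↦ Multiplicative.toAdd (e i)) (by simp [x])
    refine ⟨x, funext fun i ↦ ?_⟩
    rw [hφ, ← h]
    simp
  have hM : ∀ z : Fin (rank K) → Multiplicative ℤ, z ^ 2 = 1 → z = 1 :=
    fun z hz ↦ sq_eq_one.mp hz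
  have h := index_range_powMonoidHom_eq φ hM
  rw [hker, hrange, relIndex_torsion_sq,
    relIndex_sq_of_index_ne_zero ⊤ (by rw [index_top]; exact one_ne_zero), Fintype.card_fin] at h
  rw [h, ← pow_succ]
  congr 1
  have : 0 < Fintype.card (InfinitePlace K) := Fintype.card_pos
  rw [rank]
  omega

end UnitsNF

/-! `S`-units modulo squares: O'Meara 65:6 -/

section SUnits

open _root_.NumberField NumberField.Units IsDedekindDomain
open scoped nonZeroDivisors

variable (K : Type) [Field K] [NumberField K]

/-- An element of `Kˣ` that is a unit at every finite place comes from `(𝓞 K)ˣ`. [folklore] -/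
theorem mem_range_unitsMap_of_valuation_eq_one {x : Kˣ}
    (hx : ∀ v : HeightOneSpectrum (𝓞 K), v.valuation K (x : K) = 1) :
    x ∈ (Units.map (algebraMap (𝓞 K) K : 𝓞 K →* K)).range := by
  obtain ⟨r, hr⟩ := HeightOneSpectrum.mem_integers_of_valuation_le_one K (x : K)
    fun v ↦ (hx v).le
  obtain ⟨s, hs⟩ := HeightOneSpectrum.mem_integers_of_valuation_le_one K ((x⁻¹ : Kˣ) : K)
    fun v ↦ by rw [Units.val_inv_eq_inv_val, map_inv₀, hx v, inv_one]
  have hrs : r * s = 1 := by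
    apply IsFractionRing.injective (𝓞 K) K
    rw [map_mul, hr, hs, map_one, Units.val_inv_eq_inv_val, mul_inv_cancel₀ x.ne_zero]
  refine ⟨⟨r, s, hrs, by rw [mul_comm]; exact hrs⟩, Units.ext ?_⟩
  simp [hr]

/-- For every finite place `v` there is `x ∈ Kˣ`, integral, with `v(x) ≠ 1` and `w(x) = 1` for all
`w ≠ v` (a generator of the principal ideal `v^h`, `h` the class number). [folklore] -/
theorem exists_valuation_ne_one_and_eq_one (v : HeightOneSpectrum (𝓞 K)) :
    ∃ x : Kˣ, v.valuation K (x : K) ≠ 1 ∧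
      ∀ w : HeightOneSpectrum (𝓞 K), w ≠ v → w.valuation K (x : K) = 1 := by
  classical
  have hI0 : v.asIdeal ≠ 0 := v.ne_bot
  set n := Fintype.card (ClassGroup (𝓞 K)) with hn
  have hn0 : n ≠ 0 := Fintype.card_ne_zero
  have hIn : v.asIdeal ^ n ∈ (Ideal (𝓞 K))⁰ :=
    mem_nonZeroDivisors_of_ne_zero (pow_ne_zero _ hI0)
  have hI : v.asIdeal ∈ (Ideal (𝓞 K))⁰ := mem_nonZeroDivisors_of_ne_zero hI0
  have hprinc : (v.asIdeal ^ n).IsPrincipal := by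
    rw [← ClassGroup.mk0_eq_one_iff hIn]
    have : (⟨v.asIdeal ^ n, hIn⟩ : (Ideal (𝓞 K))⁰) = ⟨v.asIdeal, hI⟩ ^ n := by
      ext; simp
    rw [this, map_pow, hn, pow_card_eq_one]
  obtain ⟨π, hπ⟩ := hprinc
  -- hπ : v.asIdeal ^ n = Submodule.span (𝓞 K) {π}
  have hπ' : v.asIdeal ^ n = Ideal.span {π} := hπ
  have hπ0 : π ≠ 0 := by
    intro h
    rw [h, Ideal.span_singleton_eq_bot.2 rfl] at hπ'
    exact pow_ne_zero _ hI0 hπ'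
  have hπK : (algebraMap (𝓞 K) K π) ≠ 0 :=
    (map_ne_zero_iff _ (IsFractionRing.injective (𝓞 K) K)).2 hπ0
  refine ⟨Units.mk0 _ hπK, ?_, fun w hw ↦ ?_⟩
  · rw [Units.val_mk0]
    apply ne_of_lt
    rw [HeightOneSpectrum.valuation_lt_one_iff_mem]
    have : π ∈ v.asIdeal ^ n := by rw [hπ']; exact Ideal.mem_span_singleton_self π
    exact Ideal.pow_le_self hn0 this
  · rw [Units.val_mk0]
    apply le_antisymm (HeightOneSpectrum.valuation_le_one w π)
    rw [← not_lt, HeightOneSpectrum.valuation_of_algebraMap,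
      HeightOneSpectrum.intValuation_lt_one_iff_dvd, ← hπ']
    intro hdvd
    have h1 : w.asIdeal ∣ v.asIdeal := (w.prime.dvd_of_dvd_pow hdvd)
    have h2 : w.asIdeal = v.asIdeal := by
      rw [Ideal.dvd_iff_le] at h1
      exact (v.isMaximal.eq_of_le w.isPrime.ne_top h1).symm  -- hmm direction
    exact hw (HeightOneSpectrum.ext h2)

/-- The index of `zpowers c` in `Multiplicative ℤ` is finite for `c ≠ 1`. [folklore] -/
theorem index_zpowers_ne_zero {c : Multiplicative ℤ} (hc : c ≠ 1) :
    (Subgroup.zpowers c).index ≠ 0 := by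
  have h : Subgroup.zpowers c = AddSubgroup.toSubgroup (AddSubgroup.zmultiples (Multiplicative.toAdd c)) := by
    ext x
    simp only [Subgroup.mem_zpowers_iff, Multiplicative.mem_toSubgroup,
      AddSubgroup.mem_zmultiples_iff]
    constructor
    · rintro ⟨k, rfl⟩
      exact ⟨k, by rw [toAdd_zpow, smul_eq_mul, mul_comm]⟩
    · rintro ⟨k, hk⟩
      refine ⟨k, ?_⟩
      apply Multiplicative.toAdd.injective
      rw [toAdd_zpow, ← hk, smul_eq_mul, mul_comm]
  rw [h, AddSubgroup.index_toSubgroup, Int.index_zmultiples]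
  intro h0
  rw [Int.natAbs_eq_zero] at h0
  exact hc (Multiplicative.toAdd.injective (by rw [h0, toAdd_one]))

/-- **O'Meara 65:6, proved**: `(𝔲 : 𝔲²) = 2 ^ (|T| + #InfinitePlace K)` for the `T`-units
`𝔲 = {x ∈ Kˣ | v(x) = 1 ∀ v ∉ T}` of a number field `K` and every finite set `T` of finite places
(O'Meara: `(𝔲 : 𝔲²) = 2^s`, `s = |Ω - S|`, `S = {v ∉ T}`). [cite: Omeara1963, §65B Prop. 65:6] -/
theorem sUnits_sq_relIndex (T : Finset (HeightOneSpectrum (𝓞 K))) :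
    (((↑T : Set (HeightOneSpectrum (𝓞 K))).unit K).map (powMonoidHom 2)).relIndex
        ((↑T : Set (HeightOneSpectrum (𝓞 K))).unit K) =
      2 ^ (T.card + Fintype.card (InfinitePlace K)) := by
  classical
  set u : Subgroup Kˣ := (↑T : Set (HeightOneSpectrum (𝓞 K))).unit K with hu
  have hmem : ∀ {x : Kˣ}, x ∈ u ↔ ∀ v ∉ T, v.valuation K (x : K) = 1 := fun {x} ↦ Iff.rfl
  rw [relIndex_map_powMonoidHom_eq]
  -- the valuation vector on `T`
  let φ : u →* (↥T → Multiplicative ℤ) :=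
    (MonoidHom.pi fun v : ↥T ↦ (v.1.valuationOfNeZero (K := K))).comp u.subtype
  have hφ : ∀ (x : u) (v : ↥T), φ x v = v.1.valuationOfNeZero (K := K) (x : Kˣ) := fun _ _ ↦ rfl
  have hM : ∀ z : ↥T → Multiplicative ℤ, z ^ 2 = 1 → z = 1 := fun z hz ↦
    sq_eq_one.mp hz
  have hGL := index_range_powMonoidHom_eq φ hM
  -- kernel: the global units
  set ι : (𝓞 K)ˣ →* Kˣ := Units.map (algebraMap (𝓞 K) K : 𝓞 K →* K) with hι
  have hιinj : Function.Injective ι := by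
    intro a b hab
    have := congrArg (fun z : Kˣ ↦ (z : K)) hab
    simp only [hι, Units.coe_map, MonoidHom.coe_coe] at this
    exact Units.ext (IsFractionRing.injective (𝓞 K) K this)
  have hker : φ.ker.map u.subtype = ι.range := by
    ext x
    constructor
    · rintro ⟨y, hy, rfl⟩
      replace hy := MonoidHom.mem_ker.1 hy
      apply mem_range_unitsMap_of_valuation_eq_one K
      intro v
      by_cases hv : v ∈ T
      · have h := congrFun hy ⟨v, hv⟩
        rw [hφ, Pi.one_apply] at h
        have h' := congrArg (fun z : Multiplicative ℤ ↦ (z : WithZero (Multiplicative ℤ))) h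
        simp only [HeightOneSpectrum.valuationOfNeZero_eq] at h'
        exact h'
      · exact hmem.1 y.2 v hv
    · rintro ⟨e, rfl⟩
      have hval : ∀ v : HeightOneSpectrum (𝓞 K), v.valuation K ((ι e : Kˣ) : K) = 1 := by
        intro v
        have h := HeightOneSpectrum.valuation_of_unit_eq v (K := K) e
        have h' := congrArg (fun z : Multiplicative ℤ ↦ (z : WithZero (Multiplicative ℤ))) h
        simp only [HeightOneSpectrum.valuationOfNeZero_eq] at h'
        exact h'
      refine ⟨⟨ι e, hmem.2 fun v _ ↦ hval v⟩, ?_, rfl⟩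
      refine (MonoidHom.mem_ker).2 ?_
      funext v
      rw [hφ, Pi.one_apply]
      exact HeightOneSpectrum.valuation_of_unit_eq v.1 e
  have hker' : ((φ.ker).map (powMonoidHom 2)).relIndex φ.ker =
      2 ^ Fintype.card (InfinitePlace K) := by
    rw [← relIndex_map_map_of_injective _ _ u.subtype_injective, Subgroup.map_map]
    have hc : u.subtype.comp (powMonoidHom 2) = (powMonoidHom 2).comp u.subtype := by
      ext; simp
    rw [hc, ← Subgroup.map_map, hker, relIndex_map_powMonoidHom_range ι hιinj,
      index_range_powMonoidHom_units]
  -- image: finite index in `ℤ^T`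
  have hrange : φ.range.index ≠ 0 := by
    choose x hxv hxw using fun v : HeightOneSpectrum (𝓞 K) ↦ exists_valuation_ne_one_and_eq_one K v
    have hxu : ∀ v : ↥T, x v.1 ∈ u := fun v ↦ hmem.2 fun w hw ↦ hxw v.1 w (fun h ↦ hw (h ▸ v.2))
    let c : ↥T → Multiplicative ℤ := fun v ↦ φ ⟨x v.1, hxu v⟩ v
    have hc1 : ∀ v, c v ≠ 1 := by
      intro v h
      apply hxv v.1
      have h' := congrArg (fun z : Multiplicative ℤ ↦ (z : WithZero (Multiplicative ℤ))) h
      simp only [c, hφ, HeightOneSpectrum.valuationOfNeZero_eq] at h'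
      exact h'
    have hsingle : ∀ v, φ ⟨x v.1, hxu v⟩ = Pi.mulSingle v (c v) := by
      intro v
      funext w
      by_cases hw : w = v
      · subst hw; simp [c]
      · rw [Pi.mulSingle_eq_of_ne hw, hφ]
        have h := hxw v.1 w.1 (fun h ↦ hw (Subtype.ext h))
        apply WithZero.coe_inj.1  -- (↑· : Multiplicative ℤ → ℤᵐ⁰) injective
        rw [HeightOneSpectrum.valuationOfNeZero_eq]
        exact h
    let PiSub : Subgroup (↥T → Multiplicative ℤ) :=
      Subgroup.pi Set.univ fun v ↦ Subgroup.zpowers (c v)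
    have hPile : PiSub ≤ φ.range := by
      intro e he
      have he' : ∀ v, ∃ k : ℤ, (c v) ^ k = e v := fun v ↦
        Subgroup.mem_zpowers_iff.1 (he v (Set.mem_univ _))
      choose k hk using he'
      refine ⟨∏ v, ⟨x v.1, hxu v⟩ ^ k v, ?_⟩
      rw [map_prod]
      funext w
      rw [Finset.prod_apply]
      simp only [map_zpow, hsingle, Pi.pow_apply]
      rw [Finset.prod_eq_single w]
      · rw [Pi.mulSingle_eq_same, hk]
      · intro v _ hv; rw [Pi.mulSingle_eq_of_ne (Ne.symm hv), one_zpow]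
      · intro h; exact absurd (Finset.mem_univ w) h
    have hPi : PiSub.index ≠ 0 := by
      rw [Subgroup.index_pi]
      exact Finset.prod_ne_zero_iff.2 fun v _ ↦ index_zpowers_ne_zero (hc1 v)
    intro h0
    have := Subgroup.index_dvd_of_le hPile
    rw [h0] at this
    exact hPi (Nat.eq_zero_of_zero_dvd this)
  have hrange' : ((φ.range).map (powMonoidHom 2)).relIndex φ.range = 2 ^ T.card := by
    rw [relIndex_sq_of_index_ne_zero _ hrange, Fintype.card_coe]
  rw [hGL, hrange', hker', pow_add]

/-- **O'Meara 65:6 holds** (discharge of the named fact `sUnits_sq_relIndex_eq K` of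
`SUnitSquareClasses.lean`; the hypotheses (i), (iv) of §65A are not needed).
[cite: Omeara1963, §65B Prop. 65:6] -/
theorem sUnits_sq_relIndex_eq_holds : sUnits_sq_relIndex_eq K := fun T _ _ ↦ by
  rw [sCard_eq]
  exact sUnits_sq_relIndex K T

end SUnits

end Literature.NumberTheory.QuadraticForms.OMeara65
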